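import Summits.Ventures.PercRepro2.CaseOneStarCertT1
import Summits.Ventures.PercRepro2.CaseOneGadgetUWA1BBlockI0
import Summits.Ventures.PercRepro2.CaseOneGadgetUWA1BBlockI1
import Summits.Ventures.PercRepro2.CaseOneGadgetUWA1BBlockI2
import Summits.Ventures.PercRepro2.CaseOneGadgetUWA1BBlockI3
import Summits.Ventures.PercRepro2.CaseOneGadgetUWA1BBlockI4
import Summits.Ventures.PercRepro2.CaseOneGadgetUWA1BBlockI5
import Summits.Ventures.PercRepro2.CaseOneGadgetUWA1BBlockI6
import Summits.Ventures.PercRepro2.CaseOneGadgetUWA1BBlockI7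
import Summits.Ventures.PercRepro2.CaseOneGadgetUWA1BBlockI8
import Summits.Ventures.PercRepro2.CaseOneGadgetUWA1BBlockI9
import Summits.Ventures.PercRepro2.CaseOneGadgetUWA1BBlockI10
import Summits.Ventures.PercRepro2.CaseOneGadgetUWA1BBlockI11
import Summits.Ventures.PercRepro2.CaseOneGadgetUWA1BBlockI12
import Summits.Ventures.PercRepro2.CaseOneGadgetUWA1BBlockI13
import Summits.Ventures.PercRepro2.CaseOneGadgetUWA1BBlockI14
import Summits.Ventures.PercRepro2.CaseOneStarFactsB

/-!
# The gadget `u ~ {w, a₁, b}`, `w ~ {u, a₂, o}` (uwa1b): the cell certificates of `iAB5` (part 32a)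
(blind cell PercRepro2, p1 g34; the fourth gadget anchor of the six-form calculus — all six forms of the uwa1b gadget
as plain SFacts-cone certificate chains, generated by mining/p1/g34/uwa1b/genu.py = p1 g33's gent_uwa1.py / g25's
geno.py re-targeted; P1-G33 §6–§6″, P1-G34)

Each `eBABI ijk kl` is a nonnegative combination of `(pairwise atom) × (cell)` and cubic cell monomials — or, for the degree-4 ones, `M × eBABI ijk kl` (`M = Σ cᵢ` the total cell mass) is a nonnegative combination of `(atom) × (cell) × (cell)` and quartic cell monomials, then `SFacts.nonneg_of_sum_mul` (`CaseOneStarCertT1`) — exact LP certificates (kit j319447, every certificate re-verified exactly; data/p1/g33/gcerts_i_uwa1b.json, form `i`), here as exact `linear_combination`s over `SFacts` (the rational coefficients cleared by their common denominator). -/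

namespace Summit.Ventures.PercRepro2

namespace CaseOne

section CertABI32a
variable {R : Type*} [Field R] [LinearOrder R] [IsStrictOrderedRing R]

set_option maxHeartbeats 0 in
/-- `eBABI22311 ≥ 0`: the combination is identically zero (`ring`). -/
lemma eBABI22311_nonneg (m : SCells R) (_hf : SFactsB m) : 0 ≤ eBABI22311 m := by
  have h : eBABI22311 m = 0 := by
    unfold eBABI22311 cBABI00111 cBABI00211 cBABI01011 cBABI01111 cBABI01211 cBABI01311 cBABI02011 cBABI02111 cBABI02211 cBABI02311 cBABI10011 cBABI10111 cBABI10211 cBABI10311 cBABI11011 cBABI11111 cBABI11211 cBABI11311 cBABI12011 cBABI12111 cBABI12211 cBABI12311 cBABI20011 cBABI20111 cBABI20211 cBABI20311 cBABI21011 cBABI21111 cBABI21211 cBABI21311 cBABI22011 cBABI22111 cBABI22211 cBABI22311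
    ring
  linarith [h]

set_option maxHeartbeats 0 in
/-- `eBABI22312 ≥ 0`: the combination is identically zero (`ring`). -/
lemma eBABI22312_nonneg (m : SCells R) (_hf : SFactsB m) : 0 ≤ eBABI22312 m := by
  have h : eBABI22312 m = 0 := by
    unfold eBABI22312 cBABI00112 cBABI00212 cBABI01012 cBABI01112 cBABI01212 cBABI01312 cBABI02012 cBABI02112 cBABI02212 cBABI02312 cBABI10012 cBABI10112 cBABI10212 cBABI10312 cBABI11012 cBABI11112 cBABI11212 cBABI11312 cBABI12012 cBABI12112 cBABI12212 cBABI12312 cBABI20012 cBABI20112 cBABI20212 cBABI20312 cBABI21012 cBABI21112 cBABI21212 cBABI21312 cBABI22012 cBABI22112 cBABI22212 cBABI22312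
    ring
  linarith [h]

end CertABI32a

end CaseOne

end Summit.Ventures.PercRepro2
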